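import Summits.QuantumFields.YangMills.Theorems.UnitScaleTiltProp7LineIterVsEngineOfTower
import Summits.QuantumFields.YangMills.Theorems.UnitScaleTiltProp7TrueLinIterDefect
import Summits.QuantumFields.YangMills.Theorems.UnitScaleTiltProp7CovIterLambdaBound
import HarnessLib

/-!
# Route `UnitScaleTilt`, crux K1 «MinimiserStabilityRegPr» (stmt-QuantumFields-19200), route-R [RP] curved — THE S2′ KNIT, part E:
# the `ℓ²` structure row `hE` of ✓ p601741 `Prop7CurvedLandauCoercivity` for the families OF RECORD, from `PlaqSmall (ε(L^k)⁻²) U₀`,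
# in CLOSED FORM: `Σ_cE_c² ≤ 3(L^k)^{2d}·Σ_c‖T^{(k)}Y(c)‖² + 3(C_G + C_S²)·ε²·(L^k)^d(L^k)²·Σ_b‖Y_b‖²` (the `Q`-budget displayed)

Cell `ym3-torus`, keyed width hand `ym-routeR-w3` (D-0154 (3c); row (R1) «the S2′ knit» yielded by ★w2-20520 g3, OWNER ACK 26 (4)); sequel of part A `…CurvedLandauRowA`
(`hA` with `E_c := (L^k)^d·(‖T^{(k)}Y(c)‖ + ‖G_k(c) − S_k(c)‖ + ‖S_k(c) − X_c‖)`).  THEOREMS ONLY (0 `def`, 0 `sorry`); `--supports stmt-QuantumFields-19200`, count-neutral.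
YM₃ on T³ is a ladder rung (R3), not the Clay problem; nothing here claims the stub, the crux, d = 4 or the gap.

THE POINT.  The two `ℓ²` distances in `E_c` are tree theorems with every binder a tree letter: ✓ p608741 `sqrt_sum_normSq_reduced_sub_lineIter_le`
(`ρ‖G_k − S_k‖_{ℓ²} ≤ ρ^kκ(Σa_j)e^{(κ/ρ)Σa_j}‖Y‖_{ℓ²}`) and ✓ p613443 `sum_normSq_lineIter_sub_engine_le_of_tower` (`S_k` vs the engine functional read in the centre
frame, `X_c := ((L^k)^d)⁻¹•(g_c·A^{U₀}_cY·g_c*)`).  This file reads both from `PlaqSmall (ε(L^k)⁻²) U₀` in the [B7] Prop. 2 regime (★routeR-w2's `tower_plaq_lt` ∘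
`dist1_loopHol_le'`: per-level loop sizes `a_j = C_aεL^{2j}/L^{2k}`, `C_a = ((d+2)L)²/2`) and simplifies the constants to CLOSED FORMS: `ρ^{2k} = ((L^k)^d)⁻¹(L^k)²`,
`κ/ρ = 318·d(d+2)·L^d` EXACTLY, `Σ_{j<k}a_j ≤ C_aε/3`, `e^{1/3} ≤ 3/2` under `159·d(d+2)³·L^{d+2}·ε ≤ 1` ⇒ `‖G_k − S_k‖²_{ℓ²} ≤ C_G·ε²·((L^k)^d)⁻¹(L^k)²·‖Y‖²`,
`C_G = (318·d(d+2)·L^d)²(((d+2)L)²/2)²/4`; and at `δ := ε(L^k)⁻²` the bracket of ✓ p613443 is `C_S·ε·((L^k)^d)⁻¹`, `C_S = 2((d+2)L)³/(L(L−1)(L²−1)) + (2(d+2)L + 2d + 1)²/2`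
⇒ `‖S_k − X‖²_{ℓ²} ≤ C_S²·ε²·((L^k)^d)⁻¹(L^k)²·‖Y‖²`.  With `(t+g+s)² ≤ 3(t²+g²+s²)` this is the `hE` row of ✓ p601741 in the currency `c_E·ℓ⁵·ε²` at d = 3, PLUS the
displayed `Q`-budget `3ℓ^{2d}Σ_c‖T c‖²` (`T` = the true-average constraint value: `0` on the linearised fibre; an `O(Y²)` budget for a nonlinear pair).

WHAT IS PROVED (ns `…Theorems.Prop7CurvedLandauRowE`): §1 letters (`sum_range_pow_div_le_third`, `exp_third_le`, `kappa_eq_mul_rho`, `loop_size_geom`, `size_numerals`,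
`sq_le_of_sqrt_row`); §2 ★ `sum_normSq_reduced_sub_lineIter_le_of_tower`, ★ `sum_normSq_lineIter_sub_engine_le_of_plaqSmall`, ★★ `sum_sq_defect_le_of_tower` (any `P`,
`SU(N)`, `k ≤ m + K`).  HONEST SCOPE: bookkeeping over ✓ p608741 ∕ ✓ p613443 ∕ ✓ p607208; nothing of print is asserted beyond the cited tree theorems; d = 3 assembly
with the engine = `…CurvedLandauKnitT3`.
References: T. Bałaban, CMP 99 (1985) 389–434 [Balaban1985BackgroundPropagators] (Thm 3.11 p.416); CMP 95 (1984) 17–40 [Balaban1984PropagatorsI] ((1.18)–(1.20)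
pp.19–20); CMP 98 (1985) 17–51 [Balaban1985Averaging] (Prop. 2 (53) p.26, Prop. 3 (124)–(126) p.36); CMP 109 (1987) 249–301 [Balaban1987RG1] ((0.4) p.253).
-/

set_option autoImplicit false

noncomputable section

open scoped BigOperators Matrix.Norms.L2Operator Matrix

namespace Summit.QuantumFields.YangMills.Theorems.Prop7CurvedLandauRowE

open Literature.MathematicalPhysics.QuantumFieldTheory.Balaban1983to89
open Finset T4Continuum T4ReflectionCone BlockAveraging AveragingRT ExpMeanLog BlockAveragingEMLLinearised BlockAveragingEMLLinearisedBackground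
  BlockAveragingEMLProp2 B1RG242Torus
open B15DeterminingSets (embIter)
open B7Prop1Explicit (treeWord)
open B7Eq78Linearization (conjR)
open B10Eq27TorusAxialLog (holT unitsField toUField)
open Summit.QuantumFields.YangMills.Theorems.Prop7TrueLinIterDefect (sqrt_sum_normSq_reduced_sub_lineIter_le)
open Summit.QuantumFields.YangMills.Theorems.Prop7LineIterVsEngineOfTower (sum_normSq_lineIter_sub_engine_le_of_tower)
open Summit.QuantumFields.YangMills.Theorems.Prop7CovIterLambdaBound (tower_plaq_lt)

variable {P : Params} {N : ℕ} [NeZero N]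

/-! ## §1 Letters -/
/-- `Σ_{j<k} L^{2j}/L^{2k} ≤ 1/3` for `L ≥ 2`. [folklore] -/
theorem sum_range_pow_div_le_third {L : ℝ} (hL : 2 ≤ L) (k : ℕ) : ∑ j ∈ Finset.range k, L ^ (2 * j) / L ^ (2 * k) ≤ 1 / 3 := by
  have hL0 : 0 < L := by linarith
  have hmain : ∀ k : ℕ, ∑ j ∈ Finset.range k, L ^ (2 * j) ≤ L ^ (2 * k) / 3 := by
    intro k
    induction k with
    | zero => simp
    | succ k ih =>
      rw [Finset.sum_range_succ, show 2 * (k + 1) = 2 * k + 2 by ring, pow_add]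
      have h0 : 0 ≤ L ^ (2 * k) := by positivity
      nlinarith [show 4 ≤ L ^ 2 by nlinarith]
  rw [← Finset.sum_div, div_le_iff₀ (by positivity)]
  linarith [hmain k]
/-- `exp(1/3) ≤ 3/2` (from `1 − x ≤ e^{−x}`). [folklore] -/
theorem exp_third_le : Real.exp (1 / 3) ≤ 3 / 2 := by
  have hprod : Real.exp (1 / 3) * Real.exp (-(1 / 3 : ℝ)) = 1 := by rw [← Real.exp_add]; norm_num
  nlinarith [Real.exp_pos (1 / 3 : ℝ), Real.exp_pos (-(1 / 3 : ℝ)), Real.add_one_le_exp (-(1 / 3 : ℝ))]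

/-- The letters: `κ = 318·d(d+2)·L^d·ρ` for `ρ = √((L^d)⁻¹L²)`, `κ = 159·((d+2)L)·√(2d·L^d·2d)`. [folklore] -/
theorem kappa_eq_mul_rho (P : Params) :
    159 * (((P.d + 2) * P.L : ℕ) : ℝ) * Real.sqrt (2 * P.d * (P.L : ℝ) ^ P.d * (2 * P.d))
      = 318 * P.d * (P.d + 2) * (P.L : ℝ) ^ P.d * Real.sqrt (((P.L : ℝ) ^ P.d)⁻¹ * (P.L : ℝ) ^ 2) := by
  have hL : (0 : ℝ) < (P.L : ℝ) := by exact_mod_cast P.L_pos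
  have hLd : (0 : ℝ) < (P.L : ℝ) ^ P.d := by positivity
  have h1 : Real.sqrt (2 * P.d * (P.L : ℝ) ^ P.d * (2 * P.d)) = 2 * P.d * Real.sqrt ((P.L : ℝ) ^ P.d) := by
    rw [show (2 * P.d * (P.L : ℝ) ^ P.d * (2 * P.d) : ℝ) = (2 * P.d) ^ 2 * (P.L : ℝ) ^ P.d by ring,
      Real.sqrt_mul (sq_nonneg _), Real.sqrt_sq (by positivity)]
  have h2 : Real.sqrt (((P.L : ℝ) ^ P.d)⁻¹ * (P.L : ℝ) ^ 2) = (Real.sqrt ((P.L : ℝ) ^ P.d))⁻¹ * (P.L : ℝ) := by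
    rw [Real.sqrt_mul (by positivity), Real.sqrt_inv, Real.sqrt_sq hL.le]
  rw [h1, h2]
  have hs : 0 < Real.sqrt ((P.L : ℝ) ^ P.d) := Real.sqrt_pos.2 hLd
  have hss : Real.sqrt ((P.L : ℝ) ^ P.d) * Real.sqrt ((P.L : ℝ) ^ P.d) = (P.L : ℝ) ^ P.d := Real.mul_self_sqrt hLd.le
  have h3 : (P.L : ℝ) ^ P.d * (Real.sqrt ((P.L : ℝ) ^ P.d))⁻¹ = Real.sqrt ((P.L : ℝ) ^ P.d) := by
    rw [eq_comm, eq_mul_inv_iff_mul_eq₀ hs.ne']; exact hss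
  calc 159 * (((P.d + 2) * P.L : ℕ) : ℝ) * (2 * P.d * Real.sqrt ((P.L : ℝ) ^ P.d))
      = 318 * P.d * (P.d + 2) * (P.L : ℝ) * Real.sqrt ((P.L : ℝ) ^ P.d) := by push_cast; ring
    _ = 318 * P.d * (P.d + 2) * (P.L : ℝ) * ((P.L : ℝ) ^ P.d * (Real.sqrt ((P.L : ℝ) ^ P.d))⁻¹) := by rw [h3]
    _ = 318 * P.d * (P.d + 2) * (P.L : ℝ) ^ P.d * ((Real.sqrt ((P.L : ℝ) ^ P.d))⁻¹ * (P.L : ℝ)) := by ring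

/-- THE PER-LEVEL LOOP SIZES IN GEOMETRIC FORM along the tower of a `PlaqSmall (ε(L^k)⁻²)` background ([B7] Prop. 2 regime): for `j < k`,
`dist1(W^{(j)}_i(c)) ≤ (((d+2)L)²/2)·ε·L^{2j}/L^{2k}`. [cite: Balaban1985Averaging, Prop. 2 (53) p.26; Balaban1987RG1, (0.4) p.253] -/
theorem loop_size_geom (k : ℕ) {ε : ℝ} (hε : 0 < ε)
    (hε3 : (143 * ((((P.d + 4 : ℕ) : ℝ)) ^ 2 / 4) ^ 2) * ε ≤ 1 / 3)
    (hε2 : 2 * ε ≤ 2 * deltaSU (Fin N) / (((P.d + 4) * P.L : ℕ) : ℝ) ^ 2)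
    {U₀ : GaugeField P 0 (Matrix.specialUnitaryGroup (Fin N) ℂ)} (hU : PlaqSmall (ε * (((P.L : ℝ) ^ k)⁻¹) ^ 2) U₀) :
    ∀ j < k, ∀ (c : PBond P (j + 1)) (i : Idx P),
      dist1 (loopHol (Averaging.iter (fun i => blockAvg (P := P) (j := i) (expMeanLogSU (n := Fin N))) j U₀) c i)
        ≤ ((((P.d + 2) * P.L : ℕ) : ℝ) ^ 2 / 2) * ε * ((P.L : ℝ) ^ (2 * j) / (P.L : ℝ) ^ (2 * k)) := by
  intro j hj c i
  have hL : (0 : ℝ) < (P.L : ℝ) := by exact_mod_cast P.L_pos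
  have ha0 : 0 ≤ 2 * ε * ((P.L : ℝ) ^ j * ((P.L : ℝ) ^ k)⁻¹) ^ 2 := by positivity
  have hplaq : ∀ q : Plaq P j, dist1 (GaugeField.plaqHol (Averaging.iter (fun i => blockAvg (P := P) (j := i) (expMeanLogSU (n := Fin N))) j U₀) q)
      ≤ 2 * ε * ((P.L : ℝ) ^ j * ((P.L : ℝ) ^ k)⁻¹) ^ 2 := fun q => ((tower_plaq_lt k hε hε3 hε2 hU hj.le q).1).le
  have h := dist1_loopHol_le' ha0 hplaq c i
  refine h.trans (le_of_eq ?_)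
  have hk0' : (P.L : ℝ) ^ k ≠ 0 := by positivity
  rw [show (P.L : ℝ) ^ (2 * j) = ((P.L : ℝ) ^ j) ^ 2 by rw [← pow_mul, mul_comm],
    show (P.L : ℝ) ^ (2 * k) = ((P.L : ℝ) ^ k) ^ 2 by rw [← pow_mul, mul_comm]]
  field_simp
  ring


omit [NeZero N] in
/-- The sizes `a_j = C_aεL^{2j}/L^{2k}`, `C_a = ((d+2)L)²/2`, obey `a_j ≤ C_aε ≤ 1/24` and `C_aε < δ_N` under the two [B7] Prop. 2 numerals and `((d+2)L)²ε ≤ 1/12`.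
[folklore] -/
theorem size_numerals (k : ℕ) {ε : ℝ} (hε : 0 < ε)
    (hε2 : 2 * ε ≤ 2 * deltaSU (Fin N) / (((P.d + 4) * P.L : ℕ) : ℝ) ^ 2)
    (hε24 : (((P.d + 2) * P.L : ℕ) : ℝ) ^ 2 * ε ≤ 1 / 12) :
    (∀ j < k, ((((P.d + 2) * P.L : ℕ) : ℝ) ^ 2 / 2) * ε * ((P.L : ℝ) ^ (2 * j) / (P.L : ℝ) ^ (2 * k)) ≤ (((P.d + 2) * P.L : ℕ) : ℝ) ^ 2 / 2 * ε) ∧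
      (((P.d + 2) * P.L : ℕ) : ℝ) ^ 2 / 2 * ε ≤ 1 / 24 ∧ (((P.d + 2) * P.L : ℕ) : ℝ) ^ 2 / 2 * ε < deltaSU (Fin N) := by
  have hL : (0 : ℝ) < (P.L : ℝ) := by exact_mod_cast P.L_pos
  have hL1 : (1 : ℝ) ≤ (P.L : ℝ) := by exact_mod_cast P.L_pos
  refine ⟨fun j hj => ?_, by linarith, ?_⟩
  · have hx1 : (P.L : ℝ) ^ (2 * j) / (P.L : ℝ) ^ (2 * k) ≤ 1 := by
      rw [div_le_one (by positivity)]
      exact pow_le_pow_right₀ hL1 (by omega)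
    have h0 : 0 ≤ (((P.d + 2) * P.L : ℕ) : ℝ) ^ 2 / 2 * ε := by positivity
    calc _ ≤ (((P.d + 2) * P.L : ℕ) : ℝ) ^ 2 / 2 * ε * 1 := mul_le_mul_of_nonneg_left hx1 h0
      _ = _ := mul_one _
  · have hLn := P.L_pos
    have hD : (0 : ℝ) < (((P.d + 4) * P.L : ℕ) : ℝ) ^ 2 := by positivity
    have hδ : (((P.d + 4) * P.L : ℕ) : ℝ) ^ 2 * ε ≤ deltaSU (Fin N) := by
      have h2 : ε ≤ deltaSU (Fin N) / (((P.d + 4) * P.L : ℕ) : ℝ) ^ 2 := by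
        have : 2 * deltaSU (Fin N) / (((P.d + 4) * P.L : ℕ) : ℝ) ^ 2 = 2 * (deltaSU (Fin N) / (((P.d + 4) * P.L : ℕ) : ℝ) ^ 2) := by ring
        rw [this] at hε2; linarith
      have := (le_div_iff₀ hD).mp h2
      linarith
    have hlt : (((P.d + 2) * P.L : ℕ) : ℝ) ^ 2 / 2 < (((P.d + 4) * P.L : ℕ) : ℝ) ^ 2 := by
      have h1 : (((P.d + 2) * P.L : ℕ) : ℝ) ^ 2 < (((P.d + 4) * P.L : ℕ) : ℝ) ^ 2 := by
        have : (((P.d + 2) * P.L : ℕ) : ℝ) < (((P.d + 4) * P.L : ℕ) : ℝ) := by push_cast; nlinarith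
        exact pow_lt_pow_left₀ this (by positivity) two_ne_zero
      have h0 : 0 ≤ (((P.d + 2) * P.L : ℕ) : ℝ) ^ 2 := by positivity
      linarith
    nlinarith

/-- The scalar row behind `G_k − S_k`: from `ρ√R₂ ≤ ρ^k(Mρ)·A·E·√Y₂`, `A ≤ C_aε/3`, `E ≤ 3/2` conclude `R₂ ≤ (M²C_a²/4)·ε²·(ρ²)^k·Y₂`. [folklore] -/
theorem sq_le_of_sqrt_row {ρ M A E R₂ Y₂ Ca ε : ℝ} {k : ℕ} (hρ : 0 < ρ) (hM : 0 ≤ M) (hR : 0 ≤ R₂) (hY : 0 ≤ Y₂) (hE0 : 0 ≤ E) (hCa : 0 ≤ Ca * ε)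
    (h1 : ρ * Real.sqrt R₂ ≤ ρ ^ k * (M * ρ) * A * E * Real.sqrt Y₂) (hA3 : A ≤ Ca * ε / 3) (hE : E ≤ 3 / 2) :
    R₂ ≤ (M ^ 2 * Ca ^ 2 / 4) * ε ^ 2 * (ρ ^ 2) ^ k * Y₂ := by
  have hR0 : 0 ≤ Real.sqrt R₂ := Real.sqrt_nonneg _
  have hsY0 : 0 ≤ Real.sqrt Y₂ := Real.sqrt_nonneg _
  have hρk : 0 ≤ ρ ^ k := by positivity
  have h2 : ρ * Real.sqrt R₂ ≤ ρ * (ρ ^ k * M * A * E * Real.sqrt Y₂) := by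
    calc ρ * Real.sqrt R₂ ≤ ρ ^ k * (M * ρ) * A * E * Real.sqrt Y₂ := h1
      _ = ρ * (ρ ^ k * M * A * E * Real.sqrt Y₂) := by ring
  have h3 : Real.sqrt R₂ ≤ ρ ^ k * M * A * E * Real.sqrt Y₂ := le_of_mul_le_mul_left h2 hρ
  have h4 : A * E ≤ (Ca * ε / 3) * (3 / 2) := mul_le_mul hA3 hE hE0 (by positivity)
  have h5 : 0 ≤ ρ ^ k * M * Real.sqrt Y₂ := by positivity
  have hB : Real.sqrt R₂ ≤ ρ ^ k * M * (Ca * ε / 2) * Real.sqrt Y₂ := by nlinarith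
  calc R₂ = Real.sqrt R₂ ^ 2 := (Real.sq_sqrt hR).symm
    _ ≤ (ρ ^ k * M * (Ca * ε / 2) * Real.sqrt Y₂) ^ 2 := pow_le_pow_left₀ hR0 hB 2
    _ = (M ^ 2 * Ca ^ 2 / 4) * ε ^ 2 * (ρ ^ k) ^ 2 * Real.sqrt Y₂ ^ 2 := by ring
    _ = (M ^ 2 * Ca ^ 2 / 4) * ε ^ 2 * (ρ ^ 2) ^ k * Y₂ := by rw [Real.sq_sqrt hY, ← pow_mul, ← pow_mul, mul_comm k 2]

section RowE

variable {k : ℕ} (hk : k ≤ P.m + P.K) (U₀ : GaugeField P 0 (Matrix.specialUnitaryGroup (Fin N) ℂ)) (Y : PBond P 0 → Matrix (Fin N) (Fin N) ℂ)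
  (G S : (k : ℕ) → PBond P k → Matrix (Fin N) (Fin N) ℂ) (hG0 : ∀ b, G 0 b = Y b) (hS0 : ∀ b, S 0 b = Y b)
  (hGs : ∀ (k : ℕ) (c : PBond P (k + 1)), G (k + 1) c
      = (fderiv ℂ (eml : (Idx P → Matrix (Fin N) (Fin N) ℂ) → Matrix (Fin N) (Fin N) ℂ)
            (fun i => ((loopHol (Averaging.iter (fun i => blockAvg (P := P) (j := i) (expMeanLogSU (n := Fin N))) k U₀) c i :
              Matrix.specialUnitaryGroup (Fin N) ℂ) : Matrix (Fin N) (Fin N) ℂ))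
            (fun i => covWalkSum (Averaging.iter (fun i => blockAvg (P := P) (j := i) (expMeanLogSU (n := Fin N))) k U₀) (G k)
                (walk (emb c.src) (loopWord P.L c.dir (off i.1) i.2.1 i.2.2))
              * ((loopHol (Averaging.iter (fun i => blockAvg (P := P) (j := i) (expMeanLogSU (n := Fin N))) k U₀) c i :
                Matrix.specialUnitaryGroup (Fin N) ℂ) : Matrix (Fin N) (Fin N) ℂ))
            * star ((corr (expMeanLogSU (n := Fin N)) (Averaging.iter (fun i => blockAvg (P := P) (j := i) (expMeanLogSU (n := Fin N))) k U₀) c :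
                Matrix.specialUnitaryGroup (Fin N) ℂ) : Matrix (Fin N) (Fin N) ℂ)
          + ((corr (expMeanLogSU (n := Fin N)) (Averaging.iter (fun i => blockAvg (P := P) (j := i) (expMeanLogSU (n := Fin N))) k U₀) c :
                Matrix.specialUnitaryGroup (Fin N) ℂ) : Matrix (Fin N) (Fin N) ℂ)
            * covWalkSum (Averaging.iter (fun i => blockAvg (P := P) (j := i) (expMeanLogSU (n := Fin N))) k U₀) (G k)
                (walk (emb c.src) (List.replicate P.L (c.dir, true)))
            * star ((corr (expMeanLogSU (n := Fin N)) (Averaging.iter (fun i => blockAvg (P := P) (j := i) (expMeanLogSU (n := Fin N))) k U₀) c :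
                Matrix.specialUnitaryGroup (Fin N) ℂ) : Matrix (Fin N) (Fin N) ℂ))
        - ((((Fintype.card (Idx P) : ℂ))⁻¹ • ∑ i : Idx P,
              covWalkSum (Averaging.iter (fun i => blockAvg (P := P) (j := i) (expMeanLogSU (n := Fin N))) k U₀) (G k) (walk (emb c.src) (stairWord i.2.1 (off i.1))))
            - ((Averaging.iter (fun i => blockAvg (P := P) (j := i) (expMeanLogSU (n := Fin N))) (k + 1) U₀ c : Matrix.specialUnitaryGroup (Fin N) ℂ) :
                Matrix (Fin N) (Fin N) ℂ)
              * (((Fintype.card (Idx P) : ℂ))⁻¹ • ∑ i : Idx P,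
                  covWalkSum (Averaging.iter (fun i => blockAvg (P := P) (j := i) (expMeanLogSU (n := Fin N))) k U₀) (G k) (walk (emb c.tgt) (stairWord i.2.1 (off i.1))))
              * star ((Averaging.iter (fun i => blockAvg (P := P) (j := i) (expMeanLogSU (n := Fin N))) (k + 1) U₀ c :
                Matrix.specialUnitaryGroup (Fin N) ℂ) : Matrix (Fin N) (Fin N) ℂ)))
    (hSs : ∀ (k : ℕ) (c : PBond P (k + 1)), S (k + 1) c
      = ((Fintype.card (Idx P) : ℂ))⁻¹ • ∑ i : Idx P,
          ((holAt (Averaging.iter (fun i => blockAvg (P := P) (j := i) (expMeanLogSU (n := Fin N))) k U₀) (walk (emb c.src) (stairWord i.2.1 (off i.1))) :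
              Matrix.specialUnitaryGroup (Fin N) ℂ) : Matrix (Fin N) (Fin N) ℂ) *
            covWalkSum (Averaging.iter (fun i => blockAvg (P := P) (j := i) (expMeanLogSU (n := Fin N))) k U₀) (S k)
              (walk (walkEnd (emb c.src) (stairWord i.2.1 (off i.1))) (List.replicate P.L (c.dir, true))) *
          star ((holAt (Averaging.iter (fun i => blockAvg (P := P) (j := i) (expMeanLogSU (n := Fin N))) k U₀) (walk (emb c.src) (stairWord i.2.1 (off i.1))) :
              Matrix.specialUnitaryGroup (Fin N) ℂ) : Matrix (Fin N) (Fin N) ℂ))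
  {ε : ℝ} (hε : 0 < ε)
  (hε3 : (143 * ((((P.d + 4 : ℕ) : ℝ)) ^ 2 / 4) ^ 2) * ε ≤ 1 / 3)
  (hε2 : 2 * ε ≤ 2 * deltaSU (Fin N) / (((P.d + 4) * P.L : ℕ) : ℝ) ^ 2)
  (hε24 : (((P.d + 2) * P.L : ℕ) : ℝ) ^ 2 * ε ≤ 1 / 12)
  (hU : PlaqSmall (ε * (((P.L : ℝ) ^ k)⁻¹) ^ 2) U₀)

/-! ## §2 The two `ℓ²` distances in closed form, and the row `hE` -/

include hk hG0 hS0 hGs hSs hε hε3 hε2 hε24 hU in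
/-- ★ **`G_k − S_k` IN `ℓ²` ALONG THE TOWER, CLOSED FORM** (✓ p608741 read at geometric sizes): from `PlaqSmall (ε(L^k)⁻²) U₀`, the [B7] Prop. 2 numerals,
`((d+2)L)²ε ≤ 1/12` and `159·d(d+2)³·L^{d+2}·ε ≤ 1` (so that `(κ/ρ)·Σ_{j<k}a_j ≤ 1/3`), for `k ≤ m + K`:
`Σ_c‖G_k(c) − S_k(c)‖² ≤ ((318·d(d+2)·L^d)²·(((d+2)L)²/2)²/4)·ε²·((L^k)^d)⁻¹(L^k)²·Σ_b‖Y_b‖²`.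
[cite: Balaban1984PropagatorsI, (1.18)-(1.20) pp.19-20; Balaban1985Averaging, Prop. 3 (124)-(126) p.36] -/
theorem sum_normSq_reduced_sub_lineIter_le_of_tower (hεκ : 159 * P.d * ((P.d : ℝ) + 2) ^ 3 * (P.L : ℝ) ^ (P.d + 2) * ε ≤ 1) :
    ∑ c : PBond P k, ‖G k c - S k c‖ ^ 2
      ≤ ((318 * P.d * ((P.d : ℝ) + 2) * (P.L : ℝ) ^ P.d) ^ 2 * ((((P.d + 2) * P.L : ℕ) : ℝ) ^ 2 / 2) ^ 2 / 4) * ε ^ 2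
          * ((((P.L : ℝ) ^ k) ^ P.d)⁻¹ * ((P.L : ℝ) ^ k) ^ 2) * ∑ b : PBond P 0, ‖Y b‖ ^ 2 := by
  have hL : (0 : ℝ) < (P.L : ℝ) := by exact_mod_cast P.L_pos
  have hL2 : (2 : ℝ) ≤ (P.L : ℝ) := by exact_mod_cast P.hL.2
  have hCa0 : (0 : ℝ) ≤ (((P.d + 2) * P.L : ℕ) : ℝ) ^ 2 / 2 := by positivity
  have ha0 : ∀ j : ℕ, (0 : ℝ) ≤ (((P.d + 2) * P.L : ℕ) : ℝ) ^ 2 / 2 * ε * ((P.L : ℝ) ^ (2 * j) / (P.L : ℝ) ^ (2 * k)) := fun j => by positivity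
  obtain ⟨hale, h24, hN⟩ := size_numerals (N := N) k hε hε2 hε24
  have hα := loop_size_geom (N := N) k hε hε3 hε2 hU
  obtain ⟨h1, -⟩ := sqrt_sum_normSq_reduced_sub_lineIter_le U₀ Y G S hG0 hS0 hGs hSs
    (fun j => (((P.d + 2) * P.L : ℕ) : ℝ) ^ 2 / 2 * ε * ((P.L : ℝ) ^ (2 * j) / (P.L : ℝ) ^ (2 * k))) ha0 hk
    (fun j hj c i => hα j hj c i) (fun j hj => (hale j hj).trans h24) (fun j hj => (hale j hj).trans_lt hN)
  rw [kappa_eq_mul_rho P] at h1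
  -- positivity letters
  have hρpos : 0 < Real.sqrt (((P.L : ℝ) ^ P.d)⁻¹ * (P.L : ℝ) ^ 2) := Real.sqrt_pos.2 (by positivity)
  have hM0 : (0 : ℝ) ≤ 318 * P.d * ((P.d : ℝ) + 2) * (P.L : ℝ) ^ P.d := by positivity
  -- `A ≤ C_aε/3`
  have hA3 : ∑ j ∈ Finset.range k, (((P.d + 2) * P.L : ℕ) : ℝ) ^ 2 / 2 * ε * ((P.L : ℝ) ^ (2 * j) / (P.L : ℝ) ^ (2 * k))
      ≤ (((P.d + 2) * P.L : ℕ) : ℝ) ^ 2 / 2 * ε / 3 := by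
    rw [← Finset.mul_sum]
    have := sum_range_pow_div_le_third hL2 k
    have h0 : 0 ≤ (((P.d + 2) * P.L : ℕ) : ℝ) ^ 2 / 2 * ε := by positivity
    nlinarith
  -- the exponent `M·A ≤ 1/3`
  have hMCa : 318 * P.d * ((P.d : ℝ) + 2) * (P.L : ℝ) ^ P.d * ((((P.d + 2) * P.L : ℕ) : ℝ) ^ 2 / 2 * ε) ≤ 1 := by
    have : 318 * P.d * ((P.d : ℝ) + 2) * (P.L : ℝ) ^ P.d * ((((P.d + 2) * P.L : ℕ) : ℝ) ^ 2 / 2 * ε)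
        = 159 * P.d * ((P.d : ℝ) + 2) ^ 3 * (P.L : ℝ) ^ (P.d + 2) * ε := by push_cast; ring
    rw [this]; exact hεκ
  have hexp : Real.exp (318 * P.d * ((P.d : ℝ) + 2) * (P.L : ℝ) ^ P.d * Real.sqrt (((P.L : ℝ) ^ P.d)⁻¹ * (P.L : ℝ) ^ 2)
        / Real.sqrt (((P.L : ℝ) ^ P.d)⁻¹ * (P.L : ℝ) ^ 2)
        * ∑ j ∈ Finset.range k, (((P.d + 2) * P.L : ℕ) : ℝ) ^ 2 / 2 * ε * ((P.L : ℝ) ^ (2 * j) / (P.L : ℝ) ^ (2 * k))) ≤ 3 / 2 := by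
    rw [mul_div_assoc, div_self hρpos.ne', mul_one]
    refine (Real.exp_le_exp.2 ?_).trans exp_third_le
    nlinarith
  have hmain := sq_le_of_sqrt_row hρpos hM0 (by positivity) (by positivity) (Real.exp_pos _).le (by positivity) h1 hA3 hexp
  refine hmain.trans (le_of_eq ?_)
  have hρk : (((P.L : ℝ) ^ P.d)⁻¹ * (P.L : ℝ) ^ 2) ^ k = (((P.L : ℝ) ^ k) ^ P.d)⁻¹ * ((P.L : ℝ) ^ k) ^ 2 := by
    rw [mul_pow, inv_pow, ← pow_mul, ← pow_mul, ← pow_mul, ← pow_mul, mul_comm P.d k, mul_comm 2 k]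
  rw [Real.sq_sqrt (by positivity), hρk]

include hk hS0 hSs hε hε3 hε2 hε24 hU in
/-- ★ **`S_k` VERSUS THE ENGINE FUNCTIONAL IN `ℓ²`, CLOSED FORM** (✓ p613443 read at `δ := ε(L^k)⁻²` and `C_a = ((d+2)L)²/2`): from `PlaqSmall (ε(L^k)⁻²) U₀`, the
[B7] Prop. 2 numerals and `((d+2)L)²ε ≤ 1/12`, for `k ≤ m + K`:
`Σ_c‖S_k(c) − ((L^k)^d)⁻¹•(g_c·A^{U₀}_cY·g_c*)‖² ≤ C_S²·ε²·((L^k)^d)⁻¹(L^k)²·Σ_b‖Y_b‖²`, `C_S = 2((d+2)L)³/(L(L−1)(L²−1)) + (2(d+2)L + 2d + 1)²/2`.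
[cite: Balaban1985BackgroundPropagators, Thm 3.11 p.416; Balaban1984PropagatorsI, (1.18) p.20] -/
theorem sum_normSq_lineIter_sub_engine_le_of_plaqSmall :
    ∑ c : PBond P k, ‖S k c - (((P.L : ℂ) ^ k) ^ P.d)⁻¹ •
        (((holAt U₀ (walk (embIter k c.src) (treeWord fun _ : Fin P.d => -(((P.L ^ k - 1) / 2 : ℕ) : ℤ))) : Matrix.specialUnitaryGroup (Fin N) ℂ) :
            Matrix (Fin N) (Fin N) ℂ)
          * (∑ r : Fin P.d → Fin (P.L ^ k), ∑ s ∈ Finset.range (P.L ^ k),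
              conjR (holT (unitsField (toUField U₀)) (Site.fibreSite 0 k c.src fun _ => ⟨0, pow_pos P.L_pos k⟩) (treeWord fun ν => ((r ν : ℕ) : ℤ))
                  * holT (unitsField (toUField U₀)) (Site.fibreSite 0 k c.src r) (List.replicate s (c.dir, true)))
                (Y ⟨(fun z : Site P 0 => z.shift c.dir)^[s] (Site.fibreSite 0 k c.src r), c.dir⟩))
          * star (((holAt U₀ (walk (embIter k c.src) (treeWord fun _ : Fin P.d => -(((P.L ^ k - 1) / 2 : ℕ) : ℤ))) : Matrix.specialUnitaryGroup (Fin N) ℂ) :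
              Matrix (Fin N) (Fin N) ℂ)))‖ ^ 2
      ≤ (2 * (((P.d + 2) * P.L : ℕ) : ℝ) ^ 3 / ((P.L : ℝ) * ((P.L : ℝ) - 1) * ((P.L : ℝ) ^ 2 - 1))
            + ((2 * (((P.d + 2) * P.L : ℕ) : ℝ) + 2 * P.d + 1)) ^ 2 / 2) ^ 2 * ε ^ 2
          * ((((P.L : ℝ) ^ k) ^ P.d)⁻¹ * ((P.L : ℝ) ^ k) ^ 2) * ∑ b : PBond P 0, ‖Y b‖ ^ 2 := by
  have hL : (0 : ℝ) < (P.L : ℝ) := by exact_mod_cast P.L_pos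
  have hL2 : (2 : ℝ) ≤ (P.L : ℝ) := by exact_mod_cast P.hL.2
  have hCa0 : (0 : ℝ) ≤ (((P.d + 2) * P.L : ℕ) : ℝ) ^ 2 / 2 := by positivity
  have hδ0 : (0 : ℝ) ≤ ε * (((P.L : ℝ) ^ k)⁻¹) ^ 2 := by positivity
  obtain ⟨hale, h24, hN⟩ := size_numerals (N := N) k hε hε2 hε24
  have hα := loop_size_geom (N := N) k hε hε3 hε2 hU
  have h := sum_normSq_lineIter_sub_engine_le_of_tower hk U₀ Y hCa0 hε.le hδ0 hU hα (by linarith) hN S hS0 hSs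
  refine h.trans (le_of_eq ?_)
  have hk0 : ((P.L : ℝ) ^ k) ≠ 0 := by positivity
  have hkd0 : (((P.L : ℝ) ^ k) ^ P.d) ≠ 0 := by positivity
  have hL1 : (P.L : ℝ) - 1 ≠ 0 := by linarith
  have hL21 : (P.L : ℝ) ^ 2 - 1 ≠ 0 := by nlinarith
  have hL0 : (P.L : ℝ) ≠ 0 := hL.ne'
  -- the bracket is `C_S·ε`
  have hbr : 2 * ((((P.d + 2) * P.L : ℕ) : ℝ) * (2 * ((((P.d + 2) * P.L : ℕ) : ℝ) ^ 2 / 2) / ((P.L : ℝ) * ((P.L : ℝ) - 1))) / ((P.L : ℝ) ^ 2 - 1)) * ε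
        + ((((2 * ((P.d + 2) * P.L) * P.L ^ k + (2 * P.d + 1) * P.L ^ k : ℕ) : ℝ)) ^ 2 / 2) * (ε * (((P.L : ℝ) ^ k)⁻¹) ^ 2)
      = (2 * (((P.d + 2) * P.L : ℕ) : ℝ) ^ 3 / ((P.L : ℝ) * ((P.L : ℝ) - 1) * ((P.L : ℝ) ^ 2 - 1))
            + ((2 * (((P.d + 2) * P.L : ℕ) : ℝ) + 2 * P.d + 1)) ^ 2 / 2) * ε := by
    push_cast
    field_simp
    ring
  rw [hbr]
  field_simp

include hk hG0 hS0 hGs hSs hε hε3 hε2 hε24 hU in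
/-- ★★ **THE ROW `hE` OF S2′ PLUS THE DISPLAYED `Q`-BUDGET, FROM THE TOWER.**  For `k ≤ m + K`, `PlaqSmall (ε(L^k)⁻²) U₀` and the four smallness numerals, the reduced
family `G` and the pure `LINE` family `S` of record, ANY `k`-bond field `T` (intended: the true-average constraint value `T^{(k)}Y`):
`Σ_c ((L^k)^d·(‖T c‖ + ‖G_k(c) − S_k(c)‖ + ‖S_k(c) − X_c‖))² ≤ 3((L^k)^d)²·Σ_c‖T c‖² + 3(C_G + C_S²)·ε²·(L^k)^d(L^k)²·Σ_b‖Y_b‖²` with the closed forms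
`C_G = (318·d(d+2)·L^d)²(((d+2)L)²/2)²/4`, `C_S = 2((d+2)L)³/(L(L−1)(L²−1)) + (2(d+2)L + 2d + 1)²/2` — at d = 3 the `c_E·ℓ⁵·ε²` currency of ✓ p601741.
[cite: Balaban1985BackgroundPropagators, Thm 3.11 p.416; Balaban1984PropagatorsI, (1.18)-(1.20) pp.19-20; Balaban1985Averaging, Prop. 3 (124)-(126) p.36] -/
theorem sum_sq_defect_le_of_tower (hεκ : 159 * P.d * ((P.d : ℝ) + 2) ^ 3 * (P.L : ℝ) ^ (P.d + 2) * ε ≤ 1) (T : PBond P k → Matrix (Fin N) (Fin N) ℂ) :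
    ∑ c : PBond P k, (((P.L : ℝ) ^ k) ^ P.d * (‖T c‖ + ‖G k c - S k c‖ + ‖S k c - (((P.L : ℂ) ^ k) ^ P.d)⁻¹ •
        (((holAt U₀ (walk (embIter k c.src) (treeWord fun _ : Fin P.d => -(((P.L ^ k - 1) / 2 : ℕ) : ℤ))) : Matrix.specialUnitaryGroup (Fin N) ℂ) :
            Matrix (Fin N) (Fin N) ℂ)
          * (∑ r : Fin P.d → Fin (P.L ^ k), ∑ s ∈ Finset.range (P.L ^ k),
              conjR (holT (unitsField (toUField U₀)) (Site.fibreSite 0 k c.src fun _ => ⟨0, pow_pos P.L_pos k⟩) (treeWord fun ν => ((r ν : ℕ) : ℤ))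
                  * holT (unitsField (toUField U₀)) (Site.fibreSite 0 k c.src r) (List.replicate s (c.dir, true)))
                (Y ⟨(fun z : Site P 0 => z.shift c.dir)^[s] (Site.fibreSite 0 k c.src r), c.dir⟩))
          * star (((holAt U₀ (walk (embIter k c.src) (treeWord fun _ : Fin P.d => -(((P.L ^ k - 1) / 2 : ℕ) : ℤ))) : Matrix.specialUnitaryGroup (Fin N) ℂ) :
              Matrix (Fin N) (Fin N) ℂ)))‖)) ^ 2
      ≤ 3 * (((P.L : ℝ) ^ k) ^ P.d) ^ 2 * ∑ c : PBond P k, ‖T c‖ ^ 2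
        + 3 * ((318 * P.d * ((P.d : ℝ) + 2) * (P.L : ℝ) ^ P.d) ^ 2 * ((((P.d + 2) * P.L : ℕ) : ℝ) ^ 2 / 2) ^ 2 / 4
              + (2 * (((P.d + 2) * P.L : ℕ) : ℝ) ^ 3 / ((P.L : ℝ) * ((P.L : ℝ) - 1) * ((P.L : ℝ) ^ 2 - 1))
                  + ((2 * (((P.d + 2) * P.L : ℕ) : ℝ) + 2 * P.d + 1)) ^ 2 / 2) ^ 2)
            * ε ^ 2 * (((P.L : ℝ) ^ k) ^ P.d * ((P.L : ℝ) ^ k) ^ 2) * ∑ b : PBond P 0, ‖Y b‖ ^ 2 := by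
  have hL : (0 : ℝ) < (P.L : ℝ) := by exact_mod_cast P.L_pos
  have hG := sum_normSq_reduced_sub_lineIter_le_of_tower hk U₀ Y G S hG0 hS0 hGs hSs hε hε3 hε2 hε24 hU hεκ
  have hS := sum_normSq_lineIter_sub_engine_le_of_plaqSmall hk U₀ Y S hS0 hSs hε hε3 hε2 hε24 hU
  set ℓd : ℝ := ((P.L : ℝ) ^ k) ^ P.d with hℓd
  set ℓ2 : ℝ := ((P.L : ℝ) ^ k) ^ 2 with hℓ2
  have hℓd0 : 0 < ℓd := by positivity
  set CG : ℝ := (318 * P.d * ((P.d : ℝ) + 2) * (P.L : ℝ) ^ P.d) ^ 2 * ((((P.d + 2) * P.L : ℕ) : ℝ) ^ 2 / 2) ^ 2 / 4 with hCG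
  set CS : ℝ := 2 * (((P.d + 2) * P.L : ℕ) : ℝ) ^ 3 / ((P.L : ℝ) * ((P.L : ℝ) - 1) * ((P.L : ℝ) ^ 2 - 1))
      + ((2 * (((P.d + 2) * P.L : ℕ) : ℝ) + 2 * P.d + 1)) ^ 2 / 2 with hCS
  set SY : ℝ := ∑ b : PBond P 0, ‖Y b‖ ^ 2 with hSY
  -- pointwise `(ℓ^d(t+g+s))² ≤ 3(ℓ^d)²(t² + g² + s²)`
  have hpt : ∀ c : PBond P k, (ℓd * (‖T c‖ + ‖G k c - S k c‖ + ‖S k c - (((P.L : ℂ) ^ k) ^ P.d)⁻¹ •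
        (((holAt U₀ (walk (embIter k c.src) (treeWord fun _ : Fin P.d => -(((P.L ^ k - 1) / 2 : ℕ) : ℤ))) : Matrix.specialUnitaryGroup (Fin N) ℂ) :
            Matrix (Fin N) (Fin N) ℂ)
          * (∑ r : Fin P.d → Fin (P.L ^ k), ∑ s ∈ Finset.range (P.L ^ k),
              conjR (holT (unitsField (toUField U₀)) (Site.fibreSite 0 k c.src fun _ => ⟨0, pow_pos P.L_pos k⟩) (treeWord fun ν => ((r ν : ℕ) : ℤ))
                  * holT (unitsField (toUField U₀)) (Site.fibreSite 0 k c.src r) (List.replicate s (c.dir, true)))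
                (Y ⟨(fun z : Site P 0 => z.shift c.dir)^[s] (Site.fibreSite 0 k c.src r), c.dir⟩))
          * star (((holAt U₀ (walk (embIter k c.src) (treeWord fun _ : Fin P.d => -(((P.L ^ k - 1) / 2 : ℕ) : ℤ))) : Matrix.specialUnitaryGroup (Fin N) ℂ) :
              Matrix (Fin N) (Fin N) ℂ)))‖)) ^ 2
      ≤ 3 * ℓd ^ 2 * (‖T c‖ ^ 2 + ‖G k c - S k c‖ ^ 2 + ‖S k c - (((P.L : ℂ) ^ k) ^ P.d)⁻¹ •
        (((holAt U₀ (walk (embIter k c.src) (treeWord fun _ : Fin P.d => -(((P.L ^ k - 1) / 2 : ℕ) : ℤ))) : Matrix.specialUnitaryGroup (Fin N) ℂ) :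
            Matrix (Fin N) (Fin N) ℂ)
          * (∑ r : Fin P.d → Fin (P.L ^ k), ∑ s ∈ Finset.range (P.L ^ k),
              conjR (holT (unitsField (toUField U₀)) (Site.fibreSite 0 k c.src fun _ => ⟨0, pow_pos P.L_pos k⟩) (treeWord fun ν => ((r ν : ℕ) : ℤ))
                  * holT (unitsField (toUField U₀)) (Site.fibreSite 0 k c.src r) (List.replicate s (c.dir, true)))
                (Y ⟨(fun z : Site P 0 => z.shift c.dir)^[s] (Site.fibreSite 0 k c.src r), c.dir⟩))
          * star (((holAt U₀ (walk (embIter k c.src) (treeWord fun _ : Fin P.d => -(((P.L ^ k - 1) / 2 : ℕ) : ℤ))) : Matrix.specialUnitaryGroup (Fin N) ℂ) :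
              Matrix (Fin N) (Fin N) ℂ)))‖ ^ 2) := by
    intro c
    set t := ‖T c‖
    set g := ‖G k c - S k c‖
    set s := ‖S k c - (((P.L : ℂ) ^ k) ^ P.d)⁻¹ •
        (((holAt U₀ (walk (embIter k c.src) (treeWord fun _ : Fin P.d => -(((P.L ^ k - 1) / 2 : ℕ) : ℤ))) : Matrix.specialUnitaryGroup (Fin N) ℂ) :
            Matrix (Fin N) (Fin N) ℂ)
          * (∑ r : Fin P.d → Fin (P.L ^ k), ∑ s ∈ Finset.range (P.L ^ k),
              conjR (holT (unitsField (toUField U₀)) (Site.fibreSite 0 k c.src fun _ => ⟨0, pow_pos P.L_pos k⟩) (treeWord fun ν => ((r ν : ℕ) : ℤ))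
                  * holT (unitsField (toUField U₀)) (Site.fibreSite 0 k c.src r) (List.replicate s (c.dir, true)))
                (Y ⟨(fun z : Site P 0 => z.shift c.dir)^[s] (Site.fibreSite 0 k c.src r), c.dir⟩))
          * star (((holAt U₀ (walk (embIter k c.src) (treeWord fun _ : Fin P.d => -(((P.L ^ k - 1) / 2 : ℕ) : ℤ))) : Matrix.specialUnitaryGroup (Fin N) ℂ) :
              Matrix (Fin N) (Fin N) ℂ)))‖
    have h3 : (t + g + s) ^ 2 ≤ 3 * (t ^ 2 + g ^ 2 + s ^ 2) := by nlinarith [sq_nonneg (t - g), sq_nonneg (g - s), sq_nonneg (t - s)]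
    have hℓ2' : 0 ≤ ℓd ^ 2 := sq_nonneg _
    calc (ℓd * (t + g + s)) ^ 2 = ℓd ^ 2 * (t + g + s) ^ 2 := by ring
      _ ≤ ℓd ^ 2 * (3 * (t ^ 2 + g ^ 2 + s ^ 2)) := mul_le_mul_of_nonneg_left h3 hℓ2'
      _ = 3 * ℓd ^ 2 * (t ^ 2 + g ^ 2 + s ^ 2) := by ring
  calc _ ≤ ∑ c : PBond P k, 3 * ℓd ^ 2 * (‖T c‖ ^ 2 + ‖G k c - S k c‖ ^ 2 + ‖S k c - (((P.L : ℂ) ^ k) ^ P.d)⁻¹ •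
        (((holAt U₀ (walk (embIter k c.src) (treeWord fun _ : Fin P.d => -(((P.L ^ k - 1) / 2 : ℕ) : ℤ))) : Matrix.specialUnitaryGroup (Fin N) ℂ) :
            Matrix (Fin N) (Fin N) ℂ)
          * (∑ r : Fin P.d → Fin (P.L ^ k), ∑ s ∈ Finset.range (P.L ^ k),
              conjR (holT (unitsField (toUField U₀)) (Site.fibreSite 0 k c.src fun _ => ⟨0, pow_pos P.L_pos k⟩) (treeWord fun ν => ((r ν : ℕ) : ℤ))
                  * holT (unitsField (toUField U₀)) (Site.fibreSite 0 k c.src r) (List.replicate s (c.dir, true)))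
                (Y ⟨(fun z : Site P 0 => z.shift c.dir)^[s] (Site.fibreSite 0 k c.src r), c.dir⟩))
          * star (((holAt U₀ (walk (embIter k c.src) (treeWord fun _ : Fin P.d => -(((P.L ^ k - 1) / 2 : ℕ) : ℤ))) : Matrix.specialUnitaryGroup (Fin N) ℂ) :
              Matrix (Fin N) (Fin N) ℂ)))‖ ^ 2) :=
        Finset.sum_le_sum fun c _ => hpt c
    _ = 3 * ℓd ^ 2 * ∑ c : PBond P k, ‖T c‖ ^ 2 + 3 * ℓd ^ 2 * (∑ c : PBond P k, ‖G k c - S k c‖ ^ 2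
          + ∑ c : PBond P k, ‖S k c - (((P.L : ℂ) ^ k) ^ P.d)⁻¹ •
        (((holAt U₀ (walk (embIter k c.src) (treeWord fun _ : Fin P.d => -(((P.L ^ k - 1) / 2 : ℕ) : ℤ))) : Matrix.specialUnitaryGroup (Fin N) ℂ) :
            Matrix (Fin N) (Fin N) ℂ)
          * (∑ r : Fin P.d → Fin (P.L ^ k), ∑ s ∈ Finset.range (P.L ^ k),
              conjR (holT (unitsField (toUField U₀)) (Site.fibreSite 0 k c.src fun _ => ⟨0, pow_pos P.L_pos k⟩) (treeWord fun ν => ((r ν : ℕ) : ℤ))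
                  * holT (unitsField (toUField U₀)) (Site.fibreSite 0 k c.src r) (List.replicate s (c.dir, true)))
                (Y ⟨(fun z : Site P 0 => z.shift c.dir)^[s] (Site.fibreSite 0 k c.src r), c.dir⟩))
          * star (((holAt U₀ (walk (embIter k c.src) (treeWord fun _ : Fin P.d => -(((P.L ^ k - 1) / 2 : ℕ) : ℤ))) : Matrix.specialUnitaryGroup (Fin N) ℂ) :
              Matrix (Fin N) (Fin N) ℂ)))‖ ^ 2) := by
        rw [← Finset.mul_sum, Finset.sum_add_distrib, Finset.sum_add_distrib]; ring
    _ ≤ 3 * ℓd ^ 2 * ∑ c : PBond P k, ‖T c‖ ^ 2 + 3 * ℓd ^ 2 * (CG * ε ^ 2 * (ℓd⁻¹ * ℓ2) * SY + CS ^ 2 * ε ^ 2 * (ℓd⁻¹ * ℓ2) * SY) := by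
        have h0 : 0 ≤ 3 * ℓd ^ 2 := by positivity
        have := add_le_add hG hS
        exact add_le_add le_rfl (mul_le_mul_of_nonneg_left this h0)
    _ = 3 * ℓd ^ 2 * ∑ c : PBond P k, ‖T c‖ ^ 2 + 3 * (CG + CS ^ 2) * ε ^ 2 * (ℓd * ℓ2) * SY := by
        field_simp

end RowE

end Summit.QuantumFields.YangMills.Theorems.Prop7CurvedLandauRowE

end
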